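import Summits.MatrixMultiplication.MatrixMultiplication.Theorems.FarEdgeDescentTowerStep
import HarnessLib

/-!
# Route `FarEdgeDescent` — the arithmetised full-class tower (kernel XXX-A)

decomp-mm ROOT cell (D-0178), lens 2 «structural dichotomy: special vs generic», gen 51.  THESES-FREE and
definition-free.  Kernel XXIX (`towerStage`) is ITERATED, carrying the tensor data existentially, and only
NUMBERS are exported: from any certified anchored family `⟨1,Q₀,1⟩ ⊕ ⊕ᵢ⟨aᵢ,Bᵢ,aᵢ⟩` (`aᵢ ≥ 2`, `Bᵢ ≥ 1`,
`Q₀ ≥ 1`, `bR ≤ r₀`) and any clock `N`, there are sequences `r, Q, L : ℕ → ℕ` (certificate, anchor, legs)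
and `G : ℕ → ℝ → ℝ → ℝ` (the virtual census `G j s t = ∑_{block words of stage j} a^s B^t`) with
* the RECURSION `L(j+1) = (Q j + L j)^N − (Q j)^N`, `r(j+1) = (r j)^N + L(j+1)`, `Q(j+1) = (r j)^N − L(j+1)`,
  `G(j+1)(s,t) = ((Q j)^t + G j s t)^N − (Q j)^{tN}` (crude augmentation of all words except the all-anchor word);
* the SANITY bounds `Q j ≥ 1`, `(Q j + L j)^N ≤ (r j)^N` (flattening);
* the READOUT `G(j+1)(s,t) ≤ (r j)^N` at every sub-tangent `(s,t)` of `y ↦ ω(1,y,1)` (kernel XXVIII),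
so that the rate analysis of the cell memo NODE-g51 §5 (kernel XXX-B: box invariant around the fixed point
`μ(1+μ)^N = 1 − (1−μ)^N`, wedge `s − 1 ≤ C(1−t)^κ`, conversion by kernel XXVII) is TENSOR-FREE.
`crudeTowerChain_two` instantiates the start `⟨1,2,1⟩ ⊕ ⟨2,1,2⟩`, `r₀ = 6` (`bR(⟨2,1,2⟩) ≤ R ≤ 4` + one crude step).
NO definitions (gate rule D-0009): the sequences are constructed inside the proof (`Nat.rec`).
[cite: KnuthTAOCP2, §4.6.4, Ex. 67(e),(g)] [cite: Blaser2013, Thm. 7.5 (proof), Lemma 7.1(2)]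
[cite: Pan1984, §16–17] [cite: CoppersmithWinograd1982, Thm. 1] [cite: LottiRomani1983, Prop. 3.3]
-/

set_option linter.dupNamespace false

noncomputable section

open scoped BigOperators

namespace Summit.MatrixMultiplication.MatrixMultiplication.Theorems.FarEdgeDescentTowerChain

open Literature.Computability.AlgebraicComplexity
open Summit.MatrixMultiplication.MatrixMultiplication.Theorems.FarEdgeDescentVirtualPoint
open Summit.MatrixMultiplication.MatrixMultiplication.Theorems.FarEdgeDescentVirtualAdditivity
open Summit.MatrixMultiplication.MatrixMultiplication.Theorems.FarEdgeDescentTowerStep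

variable (K : Type) [Field K]

/-! ## §1 The numeric recursion (constructed, not defined) -/

/-- **The recursion exists** (trivially: primitive recursion on a quadruple). [folklore] -/
theorem chain_exists (N r₀ Q₀ L₀ : ℕ) (G₀ : ℝ → ℝ → ℝ) :
    ∃ (r Q L : ℕ → ℕ) (G : ℕ → ℝ → ℝ → ℝ),
      r 0 = r₀ ∧ Q 0 = Q₀ ∧ L 0 = L₀ ∧ G 0 = G₀ ∧
      (∀ j, L (j + 1) = (Q j + L j) ^ N - Q j ^ N) ∧
      (∀ j, r (j + 1) = r j ^ N + L (j + 1)) ∧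
      (∀ j, Q (j + 1) = r j ^ N - L (j + 1)) ∧
      (∀ j (s t : ℝ), G (j + 1) s t = (((Q j : ℕ) : ℝ) ^ t + G j s t) ^ N - (((Q j : ℕ) : ℝ) ^ t) ^ N) := by
  let step : (ℕ × ℕ × ℕ) × (ℝ → ℝ → ℝ) → (ℕ × ℕ × ℕ) × (ℝ → ℝ → ℝ) := fun x =>
    ((x.1.1 ^ N + ((x.1.2.1 + x.1.2.2) ^ N - x.1.2.1 ^ N),
      x.1.1 ^ N - ((x.1.2.1 + x.1.2.2) ^ N - x.1.2.1 ^ N),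
      (x.1.2.1 + x.1.2.2) ^ N - x.1.2.1 ^ N),
      fun s t => (((x.1.2.1 : ℕ) : ℝ) ^ t + x.2 s t) ^ N - (((x.1.2.1 : ℕ) : ℝ) ^ t) ^ N)
  let U : ℕ → (ℕ × ℕ × ℕ) × (ℝ → ℝ → ℝ) := fun j =>
    Nat.rec (motive := fun _ => (ℕ × ℕ × ℕ) × (ℝ → ℝ → ℝ)) ((r₀, Q₀, L₀), G₀) (fun _ x => step x) j
  have hU : ∀ j, U (j + 1) = step (U j) := fun j => rfl
  refine ⟨fun j => (U j).1.1, fun j => (U j).1.2.1, fun j => (U j).1.2.2, fun j => (U j).2,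
    rfl, rfl, rfl, rfl, fun j => ?_, fun j => ?_, fun j => ?_, fun j s t => ?_⟩ <;>
  simp only [hU, step]

/-! ## §2 Counting identities and the flattening bound for an anchored family -/

section Anchored

variable {p : ℕ} (a B : Fin p → ℕ) (q : ℕ)

/-- All dimensions of `⟨1,q,1⟩ ⊕ ⊕ᵢ⟨aᵢ,Bᵢ,aᵢ⟩` in the first slot are `≥ 1`. [folklore] -/
theorem cons_one_le (ha : ∀ i, 2 ≤ a i) : ∀ i, 1 ≤ (Fin.cons 1 a : Fin (p + 1) → ℕ) i := by
  intro i
  refine Fin.cases ?_ (fun i => ?_) i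
  · simp
  · simp only [Fin.cons_succ]
    exact le_trans (by norm_num) (ha i)

/-- The non-anchor letters have `a ≥ 2`. [folklore] -/
theorem cons_two_le (ha : ∀ i, 2 ≤ a i) :
    ∀ i, i ≠ (0 : Fin (p + 1)) → 2 ≤ (Fin.cons 1 a : Fin (p + 1) → ℕ) i := by
  intro i hi
  obtain ⟨i, rfl⟩ := Fin.exists_succ_eq_of_ne_zero hi
  simpa using ha i

/-- All middle dimensions are `≥ 1`. [folklore] -/
theorem cons_mid_one_le (hB : ∀ i, 1 ≤ B i) (hq : 1 ≤ q) :
    ∀ i, 1 ≤ (Fin.cons q B : Fin (p + 1) → ℕ) i := by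
  intro i
  refine Fin.cases ?_ (fun i => ?_) i
  · simpa using hq
  · simpa using hB i

variable {N M : ℕ} (hM : (p + 1) ^ N = M + 1)

/-- **Legs of the kept words**: `∑_{kept} (∏a)(∏B) = (q + ∑ aB)^N − q^N`. [folklore] -/
theorem keptLegs_eq :
    (∑ w : Fin M,
        (∏ j, (Fin.cons 1 a : Fin (p + 1) → ℕ) (finFunctionFinEquiv.symm (Fin.cast hM.symm
          ((Fin.cast hM (finFunctionFinEquiv (fun _ : Fin N => (0 : Fin (p + 1))))).succAbove w)) j)) *
        (∏ j, (Fin.cons q B : Fin (p + 1) → ℕ) (finFunctionFinEquiv.symm (Fin.cast hM.symm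
          ((Fin.cast hM (finFunctionFinEquiv (fun _ : Fin N => (0 : Fin (p + 1))))).succAbove w)) j))) =
      (q + ∑ i, a i * B i) ^ N - q ^ N := by
  have h := sum_dropAnchor_words_add
    (f := fun i : Fin (p + 1) => (Fin.cons 1 a : Fin (p + 1) → ℕ) i * (Fin.cons q B : Fin (p + 1) → ℕ) i)
    hM (0 : Fin (p + 1))
  simp only [Fin.cons_zero, one_mul, Fin.sum_univ_succ, Fin.cons_succ, Finset.prod_mul_distrib] at h
  omega

/-- **Virtual census of the kept words**: `∑_{kept} (∏a)^s (∏B)^t = (q^t + ∑ a^s B^t)^N − q^{tN}`. [folklore] -/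
theorem keptVirtual_eq (s t : ℝ) :
    (∑ w : Fin M,
        (((∏ j, (Fin.cons 1 a : Fin (p + 1) → ℕ) (finFunctionFinEquiv.symm (Fin.cast hM.symm
          ((Fin.cast hM (finFunctionFinEquiv (fun _ : Fin N => (0 : Fin (p + 1))))).succAbove w)) j) : ℕ) : ℝ)) ^ s *
        (((∏ j, (Fin.cons q B : Fin (p + 1) → ℕ) (finFunctionFinEquiv.symm (Fin.cast hM.symm
          ((Fin.cast hM (finFunctionFinEquiv (fun _ : Fin N => (0 : Fin (p + 1))))).succAbove w)) j) : ℕ) : ℝ)) ^ t) =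
      (((q : ℕ) : ℝ) ^ t + ∑ i, ((a i : ℕ) : ℝ) ^ s * ((B i : ℕ) : ℝ) ^ t) ^ N - (((q : ℕ) : ℝ) ^ t) ^ N := by
  have h := sum_dropAnchor_words_add (S := ℝ)
    (f := fun i : Fin (p + 1) =>
      (((Fin.cons 1 a : Fin (p + 1) → ℕ) i : ℕ) : ℝ) ^ s * (((Fin.cons q B : Fin (p + 1) → ℕ) i : ℕ) : ℝ) ^ t)
    hM (0 : Fin (p + 1))
  simp only [Fin.cons_zero, Nat.cast_one, Real.one_rpow, one_mul, Fin.sum_univ_succ, Fin.cons_succ] at h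
  have hw : ∀ w : Fin M,
      (∏ j, (((Fin.cons 1 a : Fin (p + 1) → ℕ) (finFunctionFinEquiv.symm (Fin.cast hM.symm
          ((Fin.cast hM (finFunctionFinEquiv (fun _ : Fin N => (0 : Fin (p + 1))))).succAbove w)) j) : ℕ) : ℝ) ^ s *
        (((Fin.cons q B : Fin (p + 1) → ℕ) (finFunctionFinEquiv.symm (Fin.cast hM.symm
          ((Fin.cast hM (finFunctionFinEquiv (fun _ : Fin N => (0 : Fin (p + 1))))).succAbove w)) j) : ℕ) : ℝ) ^ t) =
      (((∏ j, (Fin.cons 1 a : Fin (p + 1) → ℕ) (finFunctionFinEquiv.symm (Fin.cast hM.symm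
          ((Fin.cast hM (finFunctionFinEquiv (fun _ : Fin N => (0 : Fin (p + 1))))).succAbove w)) j) : ℕ) : ℝ)) ^ s *
        (((∏ j, (Fin.cons q B : Fin (p + 1) → ℕ) (finFunctionFinEquiv.symm (Fin.cast hM.symm
          ((Fin.cast hM (finFunctionFinEquiv (fun _ : Fin N => (0 : Fin (p + 1))))).succAbove w)) j) : ℕ) : ℝ)) ^ t := by
    intro w
    rw [Finset.prod_mul_distrib, Nat.cast_prod, Nat.cast_prod,
      Real.finsetProd_rpow _ _ (fun i _ => by positivity),
      Real.finsetProd_rpow _ _ (fun i _ => by positivity)]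
  rw [Finset.sum_congr rfl (fun w _ => hw w)] at h
  linarith

/-- **All legs fit under the certificate**: `(q + ∑ aB)^N ≤ ϱ^N` whenever `bR(⟨1,q,1⟩ ⊕ ⊕⟨aᵢ,Bᵢ,aᵢ⟩) ≤ ϱ`
(flattening bound on ALL words of the `N`-th power). [cite: Blaser2013, Lemma 7.1(2), Thm. 7.5 (proof)] -/
theorem allLegs_pow_le (ha : ∀ i, 2 ≤ a i) {ϱ : ℕ}
    (hc : algBorderRank (matMulDirectSum K (Fin.cons 1 a) (Fin.cons q B) (Fin.cons 1 a)) ≤ ϱ) (N : ℕ) :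
    (q + ∑ i, a i * B i) ^ N ≤ ϱ ^ N := by
  classical
  have hW := algBorderRank_subwords_le K (Fin.cons 1 a) (Fin.cons q B) (Fin.cons 1 a) N
    (fun w : Fin ((p + 1) ^ N) => w) (fun _ _ h => h) hc
  have h1 : (∑ w : Fin ((p + 1) ^ N),
      (∏ j, (Fin.cons q B : Fin (p + 1) → ℕ) (finFunctionFinEquiv.symm w j)) *
        (∏ j, (Fin.cons 1 a : Fin (p + 1) → ℕ) (finFunctionFinEquiv.symm w j))) ≤ ϱ ^ N :=
    (sum_mul_le_algBorderRank_matMulDirectSum_right K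
      (fun w : Fin ((p + 1) ^ N) => ∏ j, (Fin.cons 1 a : Fin (p + 1) → ℕ) (finFunctionFinEquiv.symm w j))
      (fun w => ∏ j, (Fin.cons q B : Fin (p + 1) → ℕ) (finFunctionFinEquiv.symm w j))
      (fun w => ∏ j, (Fin.cons 1 a : Fin (p + 1) → ℕ) (finFunctionFinEquiv.symm w j))
      (fun w => one_le_prod_word (cons_one_le a ha) _)).trans hW
  have h2 := sum_words_prod
    (fun i : Fin (p + 1) => (Fin.cons q B : Fin (p + 1) → ℕ) i * (Fin.cons 1 a : Fin (p + 1) → ℕ) i) N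
  simp only [Finset.prod_mul_distrib, Fin.sum_univ_succ, Fin.cons_zero, Fin.cons_succ, mul_one] at h2
  have h3 : (∑ i, a i * B i) = ∑ i, B i * a i := Finset.sum_congr rfl fun i _ => mul_comm _ _
  rw [h3, ← h2]
  exact h1

end Anchored

/-- Truncated-subtraction bookkeeping for the new anchor. [folklore] -/
theorem one_le_sub_sub {A b R : ℕ} (hAR : A ≤ R) (hb : 1 ≤ b) (hbA : b ≤ A) : 1 ≤ R - (A - b) := by
  omega

/-! ## §3 The chain -/

/-- **THE ARITHMETISED CRUDE FULL-CLASS TOWER.**  From a certified anchored family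
`bR(⟨1,Q₀,1⟩ ⊕ ⊕ᵢ⟨aᵢ,Bᵢ,aᵢ⟩) ≤ r₀` (`aᵢ ≥ 2`, `Bᵢ ≥ 1`, `Q₀ ≥ 1`) and a clock `N`: sequences `r, Q, L, G` with
the stated initial values, the crude full-class recursion, `Q j ≥ 1`, `(Q j + L j)^N ≤ (r j)^N`, and the virtual
readout `G (j+1) s t ≤ (r j)^N` at every sub-tangent `(s,t)` of `ω(1,·,1)` — every stage realised by an actual
border-rank certificate (kernel XXIX `towerStage`), but only the numbers are exported.
[cite: KnuthTAOCP2, §4.6.4, Ex. 67(g)] [cite: Blaser2013, Thm. 7.5 (proof)] [cite: Pan1984, §17] -/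
theorem crudeTowerChain (N : ℕ) {p₀ : ℕ} (a₀ B₀ : Fin p₀ → ℕ) (ha₀ : ∀ i, 2 ≤ a₀ i)
    (hB₀ : ∀ i, 1 ≤ B₀ i) {Q₀ r₀ : ℕ} (hQ₀ : 1 ≤ Q₀)
    (hcert : algBorderRank (matMulDirectSum K (Fin.cons 1 a₀) (Fin.cons Q₀ B₀) (Fin.cons 1 a₀)) ≤ r₀) :
    ∃ (r Q L : ℕ → ℕ) (G : ℕ → ℝ → ℝ → ℝ),
      r 0 = r₀ ∧ Q 0 = Q₀ ∧ L 0 = ∑ i, a₀ i * B₀ i ∧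
      (∀ s t : ℝ, G 0 s t = ∑ i, ((a₀ i : ℕ) : ℝ) ^ s * ((B₀ i : ℕ) : ℝ) ^ t) ∧
      (∀ j, L (j + 1) = (Q j + L j) ^ N - Q j ^ N) ∧
      (∀ j, r (j + 1) = r j ^ N + L (j + 1)) ∧
      (∀ j, Q (j + 1) = r j ^ N - L (j + 1)) ∧
      (∀ j (s t : ℝ), G (j + 1) s t = (((Q j : ℕ) : ℝ) ^ t + G j s t) ^ N - (((Q j : ℕ) : ℝ) ^ t) ^ N) ∧
      (∀ j, 1 ≤ Q j) ∧
      (∀ j, (Q j + L j) ^ N ≤ r j ^ N) ∧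
      (∀ j (s t : ℝ), (∀ y : ℝ, 0 ≤ y → s + y * t ≤ omegaRect K 1 y 1) →
        G (j + 1) s t ≤ ((r j : ℕ) : ℝ) ^ N) := by
  classical
  obtain ⟨r, Q, L, G, h0r, h0Q, h0L, h0G, hL, hr, hQ, hG⟩ :=
    chain_exists N r₀ Q₀ (∑ i, a₀ i * B₀ i) (fun s t => ∑ i, ((a₀ i : ℕ) : ℝ) ^ s * ((B₀ i : ℕ) : ℝ) ^ t)
  -- the invariant: stage `j` is realised by a certified anchored family with the recorded numbers
  have key : ∀ j, ∃ (p : ℕ) (a B : Fin p → ℕ) (q ϱ : ℕ), q = Q j ∧ ϱ = r j ∧ (∀ i, 2 ≤ a i) ∧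
      (∀ i, 1 ≤ B i) ∧ 1 ≤ q ∧
      algBorderRank (matMulDirectSum K (Fin.cons 1 a) (Fin.cons q B) (Fin.cons 1 a)) ≤ ϱ ∧
      (∑ i, a i * B i) = L j ∧
      (∀ s t : ℝ, (∑ i, ((a i : ℕ) : ℝ) ^ s * ((B i : ℕ) : ℝ) ^ t) = G j s t) := by
    intro j
    induction j with
    | zero =>
      exact ⟨p₀, a₀, B₀, Q₀, r₀, h0Q.symm, h0r.symm, ha₀, hB₀, hQ₀, hcert, h0L.symm,
        fun s t => by rw [h0G]⟩
    | succ j ih =>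
      obtain ⟨p, a, B, q, ϱ, hq, hϱ, ha, hB, hq1, hc, hLj, hGj⟩ := ih
      obtain ⟨M, hM⟩ : ∃ M, (p + 1) ^ N = M + 1 :=
        ⟨(p + 1) ^ N - 1, (Nat.succ_pred_eq_of_pos (pow_pos p.succ_pos N)).symm⟩
      have st := (towerStage K (Fin.cons 1 a) (Fin.cons q B) (cons_one_le a ha)
        (cons_mid_one_le B q hB hq1) (i₀ := 0) (cons_two_le a ha) hc hM).1
      have hlegs := keptLegs_eq a B q hM
      have hlegs' : (∑ w : Fin M,
          (∏ j, (Fin.cons q B : Fin (p + 1) → ℕ) (finFunctionFinEquiv.symm (Fin.cast hM.symm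
            ((Fin.cast hM (finFunctionFinEquiv (fun _ : Fin N => (0 : Fin (p + 1))))).succAbove w)) j)) *
          (∏ j, (Fin.cons 1 a : Fin (p + 1) → ℕ) (finFunctionFinEquiv.symm (Fin.cast hM.symm
            ((Fin.cast hM (finFunctionFinEquiv (fun _ : Fin N => (0 : Fin (p + 1))))).succAbove w)) j))) =
          (q + ∑ i, a i * B i) ^ N - q ^ N := by
        rw [← hlegs]
        exact Finset.sum_congr rfl fun w _ => mul_comm _ _
      have hall := allLegs_pow_le K a B q ha hc N
      have hqN : q ^ N ≤ (q + ∑ i, a i * B i) ^ N := Nat.pow_le_pow_left (Nat.le_add_right _ _) N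
      have hq1N : 1 ≤ q ^ N := Nat.one_le_pow _ _ hq1
      refine ⟨M, _, _, ϱ ^ N - (∑ w : Fin M,
          (∏ j, (Fin.cons q B : Fin (p + 1) → ℕ) (finFunctionFinEquiv.symm (Fin.cast hM.symm
            ((Fin.cast hM (finFunctionFinEquiv (fun _ : Fin N => (0 : Fin (p + 1))))).succAbove w)) j)) *
          (∏ j, (Fin.cons 1 a : Fin (p + 1) → ℕ) (finFunctionFinEquiv.symm (Fin.cast hM.symm
            ((Fin.cast hM (finFunctionFinEquiv (fun _ : Fin N => (0 : Fin (p + 1))))).succAbove w)) j))),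
        ϱ ^ N + (∑ w : Fin M,
          (∏ j, (Fin.cons 1 a : Fin (p + 1) → ℕ) (finFunctionFinEquiv.symm (Fin.cast hM.symm
            ((Fin.cast hM (finFunctionFinEquiv (fun _ : Fin N => (0 : Fin (p + 1))))).succAbove w)) j)) *
          (∏ j, (Fin.cons q B : Fin (p + 1) → ℕ) (finFunctionFinEquiv.symm (Fin.cast hM.symm
            ((Fin.cast hM (finFunctionFinEquiv (fun _ : Fin N => (0 : Fin (p + 1))))).succAbove w)) j))),
        ?_, ?_, fun w => two_le_prod_dropAnchor (Fin.cons 1 a) (cons_one_le a ha) (cons_two_le a ha) hM w,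
        fun w => one_le_prod_word (cons_mid_one_le B q hB hq1) _, ?_, st, ?_, fun s t => ?_⟩
      · -- new anchor = Q (j+1)
        rw [hlegs', hQ, hL, ← hq, ← hLj, ← hϱ]
      · -- new certificate = r (j+1)
        rw [hlegs, hr, hL, ← hq, ← hLj, ← hϱ]
      · -- 1 ≤ new anchor
        rw [hlegs']
        exact one_le_sub_sub hall hq1N hqN
      · -- legs
        rw [hlegs, hL, ← hq, ← hLj]
      · -- virtual census
        rw [keptVirtual_eq a B q hM s t, hG, hGj, ← hq]
  refine ⟨r, Q, L, G, h0r, h0Q, h0L, fun s t => by rw [h0G], hL, hr, hQ, hG, fun j => ?_, fun j => ?_,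
    fun j s t hst => ?_⟩
  · obtain ⟨p, a, B, q, ϱ, hq, -, -, -, hq1, -⟩ := key j
    rw [← hq]; exact hq1
  · obtain ⟨p, a, B, q, ϱ, hq, hϱ, ha, hB, hq1, hc, hLj, -⟩ := key j
    rw [← hq, ← hϱ, ← hLj]
    exact allLegs_pow_le K a B q ha hc N
  · obtain ⟨p, a, B, q, ϱ, hq, hϱ, ha, hB, hq1, hc, hLj, hGj⟩ := key j
    obtain ⟨M, hM⟩ : ∃ M, (p + 1) ^ N = M + 1 :=
      ⟨(p + 1) ^ N - 1, (Nat.succ_pred_eq_of_pos (pow_pos p.succ_pos N)).symm⟩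
    have st := (towerStage K (Fin.cons 1 a) (Fin.cons q B) (cons_one_le a ha)
      (cons_mid_one_le B q hB hq1) (i₀ := 0) (cons_two_le a ha) hc hM).2 s t hst
    rw [keptVirtual_eq a B q hM s t, hGj] at st
    rw [hG, ← hq, ← hϱ]
    exact st

/-! ## §4 The concrete start `⟨1,2,1⟩ ⊕ ⟨2,1,2⟩` -/

/-- `bR(⟨2,1,2⟩) ≤ 4` as a one-block direct sum. [cite: Blaser2013, §5] -/
theorem algBorderRank_block_two_le :
    algBorderRank (matMulDirectSum K (fun _ : Fin 1 => 2) (fun _ => 1) (fun _ => 2)) ≤ 4 := by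
  classical
  refine (tensorRestrictsTo_matMulTensor_matMulDirectSum_single K 2 1 2).algBorderRank_le.trans ?_
  refine (algBorderRank_le_tensorRank _).trans ?_
  simpa using tensorRank_matMulTensor_le K 2 1 2

/-- **The chain from `⟨1,2,1⟩ ⊕ ⟨2,1,2⟩`** (`r₀ = 6`, `Q₀ = 2`, `L₀ = 2`, `G₀(s,t) = 2^s`), any clock `N`:
the numbers of the crude full-class tower whose instrumented order at `N = 7` is
`κ = 0.30968`, `δ = κ/(1−κ) = 0.44861` (cell memo NODE-g51 §2). [cite: KnuthTAOCP2, §4.6.4, Ex. 67(g)] -/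
theorem crudeTowerChain_two (N : ℕ) :
    ∃ (r Q L : ℕ → ℕ) (G : ℕ → ℝ → ℝ → ℝ),
      r 0 = 6 ∧ Q 0 = 2 ∧ L 0 = 2 ∧ (∀ s t : ℝ, G 0 s t = (2 : ℝ) ^ s) ∧
      (∀ j, L (j + 1) = (Q j + L j) ^ N - Q j ^ N) ∧
      (∀ j, r (j + 1) = r j ^ N + L (j + 1)) ∧
      (∀ j, Q (j + 1) = r j ^ N - L (j + 1)) ∧
      (∀ j (s t : ℝ), G (j + 1) s t = (((Q j : ℕ) : ℝ) ^ t + G j s t) ^ N - (((Q j : ℕ) : ℝ) ^ t) ^ N) ∧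
      (∀ j, 1 ≤ Q j) ∧
      (∀ j, (Q j + L j) ^ N ≤ r j ^ N) ∧
      (∀ j (s t : ℝ), (∀ y : ℝ, 0 ≤ y → s + y * t ≤ omegaRect K 1 y 1) →
        G (j + 1) s t ≤ ((r j : ℕ) : ℝ) ^ N) := by
  classical
  have h0 := towerStep_of_le K (fun _ : Fin 1 => 2) (fun _ => 1) (fun _ => 2) (fun _ => by norm_num)
    (algBorderRank_block_two_le K)
  obtain ⟨r, Q, L, G, h0r, h0Q, h0L, h0G, hL, hr, hQ, hG, hQ1, hall, hread⟩ :=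
    crudeTowerChain K N (fun _ : Fin 1 => 2) (fun _ => 1) (fun _ => by norm_num) (fun _ => le_rfl)
      (Q₀ := 4 - ∑ w : Fin 1, 1 * 2) (r₀ := 4 + ∑ w : Fin 1, 2 * 1) (by simp) h0
  refine ⟨r, Q, L, G, by simpa using h0r, by simpa using h0Q, by simpa using h0L, fun s t => ?_, hL, hr,
    hQ, hG, hQ1, hall, hread⟩
  rw [h0G]
  simp

end Summit.MatrixMultiplication.MatrixMultiplication.Theorems.FarEdgeDescentTowerChain

end
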